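import Literature.NumberTheory.Transcendental.KZProductIdeal

/-!
# `BetaCancellation` (stmt-KontsevichZagierPeriods-13633) — line `dirichlet-companion-to-pi`, stub `stub_sideMirror`

Helper file of the crux lead (`--supports` stmt-KontsevichZagierPeriods-13633), registered stub
`stub_sideMirror` of the wall-descent skeleton. For a side set `S ⊆ ℝ` of the first coordinate of
the unit disc `D = KZ.piDisc = {x² + y² ≤ 1}`, the piece `D ∩ {x ∈ S}` (integrand `1`) and its
mirror image `D ∩ {-x ∈ S}` (integrand `1`) have the same class modulo `KZ.relations`: the
reflection `μ (x, y) = (-x, y)` is ONE change of variables (Kontsevich–Zagier rule (2)). It is a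
`ℚ`-polynomial (hence `ℚ`-semialgebraic) linear map, an involution (so injective), its own constant
derivative, of determinant `-1` (so `|det| = 1` and the integrands `1 = 1 · |det μ|` match), and it
carries `D ∩ {x ∈ S}` onto `D ∩ {-x ∈ S}` (`(-x)² = x²`, `-(-x) = x`). The reflection enters as a
variable `μ` pinned by its defining equation (the matrix `diag(-1, 1)`); no definitions, no notation.

References: M. Kontsevich, D. Zagier, *Periods* (2001), §1.2, rule (2).
-/

noncomputable section

-- `Summit.KontsevichZagierPeriods.KontsevichZagierPeriods.…` is the tree's mandated layout (single-conjunct summit).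
set_option linter.dupNamespace false

namespace Summit.KontsevichZagierPeriods.KontsevichZagierPeriods.BetaCancellationLine

open Set
open Literature.NumberTheory.Transcendental
open Literature.NumberTheory.Transcendental.KZ

/-! ## The reflection `μ (x, y) = (-x, y)` -/

section Mirror

variable {μ : (Fin 2 → ℝ) →L[ℝ] (Fin 2 → ℝ)}
  (hμ : μ = LinearMap.toContinuousLinearMap
    (Matrix.toLin' (!![(-1 : ℝ), 0; 0, 1] : Matrix (Fin 2) (Fin 2) ℝ)))

include hμ

/-- First coordinate of the reflection: `μ z 0 = -z 0`. [folklore] -/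
theorem sideMirror_apply_zero (z : Fin 2 → ℝ) : μ z 0 = -z 0 := by
  subst hμ
  simp [Matrix.mulVec, dotProduct, Fin.sum_univ_two]

/-- Second coordinate of the reflection: `μ z 1 = z 1`. [folklore] -/
theorem sideMirror_apply_one (z : Fin 2 → ℝ) : μ z 1 = z 1 := by
  subst hμ
  simp [Matrix.mulVec, dotProduct, Fin.sum_univ_two]

/-- `det μ = -1`. [folklore] -/
theorem sideMirror_det : μ.det = -1 := by
  subst hμ
  simp only [ContinuousLinearMap.det, LinearMap.coe_toContinuousLinearMap, LinearMap.det_toLin',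
    Matrix.det_fin_two_of]
  norm_num

/-- The reflection is an involution: `μ (μ z) = z`. [folklore] -/
theorem sideMirror_apply_apply (z : Fin 2 → ℝ) : μ (μ z) = z := by
  ext i
  fin_cases i
  · simp only [Fin.zero_eta, Fin.isValue, sideMirror_apply_zero hμ, neg_neg]
  · simp only [Fin.mk_one, Fin.isValue, sideMirror_apply_one hμ]

/-- The reflection preserves `x² + y²`. [folklore] -/
theorem sideMirror_normSq (z : Fin 2 → ℝ) : μ z 0 ^ 2 + μ z 1 ^ 2 = z 0 ^ 2 + z 1 ^ 2 := by
  rw [sideMirror_apply_zero hμ, sideMirror_apply_one hμ, neg_sq]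

/-- The reflection is a `ℚ`-semialgebraic map on any `ℚ`-semialgebraic set (its coordinates are the
`ℚ`-polynomials `-X 0`, `X 1`). [folklore] -/
theorem sideMirror_isSemialgebraicMapOn {s : Set (Fin 2 → ℝ)}
    (hs : Literature.ModelTheory.ExponentialFields.IsSemialgebraic ℚ s) :
    IsSemialgebraicMapOn ℚ s μ := by
  refine IsSemialgebraicMapOn.of_forall hs fun j => ?_
  fin_cases j
  · exact (isSemialgebraicFunOn_aeval hs (-MvPolynomial.X 0)).congr fun z _ => by
      simp [sideMirror_apply_zero hμ]
  · exact (isSemialgebraicFunOn_aeval hs (MvPolynomial.X 1)).congr fun z _ => by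
      simp [sideMirror_apply_one hμ]

/-- **The mirror of a side piece in coordinates**: `μ` carries `D ∩ {x ∈ S}` onto `D ∩ {-x ∈ S}`.
[folklore] -/
theorem sideMirror_image (S : Set ℝ) :
    μ '' (piDisc ∩ {z | z 0 ∈ S}) = piDisc ∩ {z | -z 0 ∈ S} := by
  ext w
  constructor
  · rintro ⟨z, ⟨hz, hzS⟩, rfl⟩
    rw [mem_setOf_eq] at hzS
    refine ⟨?_, ?_⟩
    · rw [mem_piDisc] at hz ⊢
      rw [sideMirror_normSq hμ]
      exact hz
    · rw [mem_setOf_eq, sideMirror_apply_zero hμ, neg_neg]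
      exact hzS
  · rintro ⟨hw, hwS⟩
    rw [mem_setOf_eq] at hwS
    refine ⟨μ w, ⟨?_, ?_⟩, sideMirror_apply_apply hμ w⟩
    · rw [mem_piDisc] at hw ⊢
      rw [sideMirror_normSq hμ]
      exact hw
    · rw [mem_setOf_eq, sideMirror_apply_zero hμ]
      exact hwS

/-- **`[D ∩ {x ∈ S}] − [D ∩ {-x ∈ S}]` is one change of variables** (the reflection `μ`,
`|det μ| = 1`, integrands `1`). [cite: KontsevichZagier2001, §1.2 rule (2)] -/
theorem sideMirror_mem_changeOfVariablesRel (S : Set ℝ) (DS DS' : IntegralRep 2)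
    (hD : DS.domain = piDisc ∩ {z | z 0 ∈ S}) (hD' : DS'.domain = piDisc ∩ {z | -z 0 ∈ S})
    (hi : DS.integrand = fun _ => 1) (hi' : DS'.integrand = fun _ => 1) :
    of DS - of DS' ∈ changeOfVariablesRel := by
  refine ⟨2, DS, DS', μ, fun _ => μ, sideMirror_isSemialgebraicMapOn hμ DS.isSemialgebraic_domain,
    fun x _ => μ.hasFDerivAt.hasFDerivWithinAt, ?_, ?_, ?_, rfl⟩
  · intro x _ y _ h
    have := congrArg μ h
    rwa [sideMirror_apply_apply hμ, sideMirror_apply_apply hμ] at this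
  · rw [hD', hD, sideMirror_image hμ]
  · intro x _
    simp only [hi, hi', sideMirror_det hμ, abs_neg, abs_one, mul_one]

end Mirror

/-! ## The registered stub -/

/-- STUB (mirror): the reflection `x ↦ -x` of the first disc coordinate carries the piece of the
unit disc over a side set `S` onto the piece over `-S`: one rule-(2) move. [folklore] -/
theorem stub_sideMirror :
    ∀ (S : Set ℝ) (DS DS' : IntegralRep 2), DS.domain = piDisc ∩ {z | z 0 ∈ S} → DS'.domain = piDisc ∩ {z | -z 0 ∈ S} → (DS.integrand = fun _ => 1) → (DS'.integrand = fun _ => 1) → of DS - of DS' ∈ relations := by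
  intro S DS DS' hD hD' hi hi'
  set μ : (Fin 2 → ℝ) →L[ℝ] (Fin 2 → ℝ) := LinearMap.toContinuousLinearMap
    (Matrix.toLin' (!![(-1 : ℝ), 0; 0, 1] : Matrix (Fin 2) (Fin 2) ℝ)) with hμ
  exact changeOfVariablesRel_subset_relations
    (sideMirror_mem_changeOfVariablesRel hμ S DS DS' hD hD' hi hi')

end Summit.KontsevichZagierPeriods.KontsevichZagierPeriods.BetaCancellationLine
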